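import Summits.Ventures.PercRepro.S1FiveCircuitBase
import Summits.Ventures.PercRepro.RankLevelSetFourCircuitNullityTwo
import Summits.Ventures.PercRepro.RankLevelSetFiveCircuitKillCount

/-!
# PercRepro — `s₅ ≤ 47` ON EVERY `e`-FREE CORE OF NULLITY `4` (p8 g8, S3; p2's base `52` sharpened)

`proofs/P8-S3-NULLITY3-SHARP.md` §5. p2's `ncard_fiveCircuits_le_fifty_two_of_eight` (S1FiveCircuitBase) kills `4` of the
`56` five-subsets of the 8-point rank-4 core `E'` by ONE small circuit found through the `e`-free partition of a point.
Here THREE pairwise distinct circuits of `≤ 4` elements are found inside `E'`: `D₁` from the partition at any `e₁`, `D₂`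
from the partition at a point `e₂ ∈ D₁` (`D₂ ∌ e₂`), and `D₃` either from a point `e₃ ∈ D₁ ∩ D₂` or — when `D₁, D₂` are
disjoint quads, `E' = D₁ ⊔ D₂` — inside the big half `B` of the partition at `e₂` (`B` has `≥ 4` points of rank `≤ 3`
and meets `D₁ ∖ e₂`, so a `4`-subset `Y` of `B` through a point of `D₁` is dependent and is neither `D₁` (`e₂ ∉ Y`) nor
`D₂`). Two distinct circuits of `≤ 4` elements span `≥ 5` points (lines have `≤ 3` points), so at most ONE five-subset
contains both; each kills `≥ 4`: `|K₁ ∪ K₂ ∪ K₃| ≥ 12 − 3 = 9` and `s₅ ≤ 56 − 9 = 47`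
(`ncard_fiveCircuits_le_forty_seven_of_eight`). With p2's `47` for `≥ 9` non-coloops: **`s₅ ≤ 47` at nullity `4`**
(`ncard_fiveCircuits_le_forty_seven`) and the chain `avgChain5c = 47, 105, 210, 360, 585, 910, 1365, …` (p2's
`avgChain5b` = `52, 117, 234, 401, 651, 1012, 1518`). The census maximum is `44`. Axioms: standard.
-/

open scoped Matroid

namespace PercRepro

namespace S1

open Set

variable {α : Type}

/-- **The big half of the `e`-free partition inside the core**: on a core of nullity `4` with `8` non-coloops, every
point `e` of `E' = E ∖ coloops` has a set `B ⊆ E' ∖ {e}` of `≥ 4` points and rank `≤ 3` with `e ∉ cl(B)` and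
`e ∉ cl((E' ∖ {e}) ∖ B)` (p2's argument, with both halves kept). -/
theorem exists_big_half_eight (M : Matroid α) [M.Finite]
    (hfree : ∀ e ∈ M.E, ∃ A ⊆ M.E \ {e}, e ∉ M.closure A ∧ e ∉ M.closure ((M.E \ {e}) \ A))
    (hd : M.E.encard = M.eRank + 4) (h8 : (M.E \ M.coloops).ncard = 8) {e : α} (he : e ∈ M.E \ M.coloops) :
    ∃ B ⊆ (M.E \ M.coloops) \ {e}, 4 ≤ B.ncard ∧ M.eRk B ≤ 3 ∧ e ∉ M.closure B ∧
      e ∉ M.closure (((M.E \ M.coloops) \ {e}) \ B) := by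
  classical
  obtain ⟨r', hr', hE'n, hr4⟩ := nonColoops_nullity_four M hfree hd
  have hr'4 : r' = 4 := by omega
  set E' := M.E \ M.coloops with hE'def
  have hE'sub : E' ⊆ M.E := sdiff_subset
  have hE'fin : E'.Finite := M.ground_finite.subset hE'sub
  have hrkE' : M.eRk E' = 4 := by rw [hr', hr'4]; rfl
  obtain ⟨A, hA, heA, heA'⟩ := hfree e (hE'sub he)
  have hrank : ∀ X ⊆ E', e ∉ M.closure X → M.eRk X ≤ 3 := by
    intro X hXE' heX
    by_contra hlt
    push Not at hlt
    have h4 : (4 : ℕ∞) ≤ M.eRk X := by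
      have := Order.add_one_le_of_lt hlt
      exact le_trans (by norm_num) this
    have hcl : M.closure X = M.closure E' :=
      (M.isRkFinite_of_finite (hE'fin.subset hXE')).closure_eq_closure_of_subset_of_eRk_ge_eRk hXE'
        (by rw [hrkE']; exact h4)
    exact heX (hcl ▸ M.subset_closure E' hE'sub he)
  set B₁ := A ∩ E' with hB₁
  set B₂ := ((M.E \ {e}) \ A) ∩ E' with hB₂
  have hB₁E : B₁ ⊆ E' \ {e} := fun x hx => ⟨hx.2, fun h => (hA hx.1).2 h⟩
  have hB₂E : B₂ ⊆ E' \ {e} := fun x hx => ⟨hx.2, fun h => hx.1.1.2 h⟩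
  have heB₁ : e ∉ M.closure B₁ := fun h => heA (M.closure_subset_closure inter_subset_left h)
  have heB₂ : e ∉ M.closure B₂ := fun h => heA' (M.closure_subset_closure inter_subset_left h)
  have hcomp₁ : (E' \ {e}) \ B₁ ⊆ B₂ := by
    intro x hx
    refine ⟨⟨⟨hE'sub hx.1.1, hx.1.2⟩, fun hxA => hx.2 ⟨hxA, hx.1.1⟩⟩, hx.1.1⟩
  have hcomp₂ : (E' \ {e}) \ B₂ ⊆ B₁ := by
    intro x hx
    by_contra hxA
    exact hx.2 ⟨⟨⟨hE'sub hx.1.1, hx.1.2⟩, fun h => hxA ⟨h, hx.1.1⟩⟩, hx.1.1⟩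
  have hcover : E' \ {e} ⊆ B₁ ∪ B₂ := fun x hx => by
    by_cases hxA : x ∈ A
    · exact Or.inl ⟨hxA, hx.1⟩
    · exact Or.inr ⟨⟨⟨hE'sub hx.1, hx.2⟩, hxA⟩, hx.1⟩
  have hcard : 4 ≤ B₁.ncard ∨ 4 ≤ B₂.ncard := by
    by_contra hno
    push Not at hno
    have h1 := ncard_le_ncard hcover ((hE'fin.subset inter_subset_right).union (hE'fin.subset inter_subset_right))
    have h2 := ncard_union_le B₁ B₂
    have h3 := ncard_sdiff_singleton_add_one he hE'fin
    omega
  rcases hcard with h | h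
  · exact ⟨B₁, hB₁E, h, hrank _ inter_subset_right heB₁, heB₁,
      fun hc => heB₂ (M.closure_subset_closure hcomp₁ hc)⟩
  · exact ⟨B₂, hB₂E, h, hrank _ inter_subset_right heB₂, heB₂,
      fun hc => heB₁ (M.closure_subset_closure hcomp₂ hc)⟩

/-- A `4`-subset of a rank-`≤ 3` set through a given point carries a circuit of `≤ 4` elements. -/
theorem exists_circuit_le_four_of_big_half (M : Matroid α) [M.Finite] {B : Set α} (hBE : B ⊆ M.E)
    (hB4 : 4 ≤ B.ncard) (hBr : M.eRk B ≤ 3) {d : α} (hd : d ∈ B) :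
    ∃ Y ⊆ B, Y.ncard = 4 ∧ d ∈ Y ∧ ∃ D ⊆ Y, M.IsCircuit D := by
  have hBfin : B.Finite := M.ground_finite.subset hBE
  obtain ⟨Y, hdY, hYB, hY4⟩ := Set.exists_subsuperset_card_eq (s := {d}) (t := B) (n := 4)
    (singleton_subset_iff.2 hd) (by rw [ncard_singleton]; omega) hB4
  have hYfin : Y.Finite := hBfin.subset hYB
  have hYdep : M.Dep Y := by
    rw [← Matroid.eRk_lt_encard_iff_dep_of_finite hYfin (hYB.trans hBE)]
    have hYenc : Y.encard = 4 := by rw [← hYfin.cast_ncard_eq, hY4]; rfl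
    rw [hYenc]
    exact lt_of_le_of_lt ((M.eRk_mono hYB).trans hBr) (by norm_num)
  obtain ⟨D, hDY, hD⟩ := hYdep.exists_isCircuit_subset
  exact ⟨Y, hYB, hY4, hdY (mem_singleton d), D, hDY, hD⟩

/-- **Two distinct circuits of a core span at least five points**: `r(C₁ ∪ C₂) + 2 ≤ |C₁ ∪ C₂|` (L0 of
RankLevelSetFourCircuitNullityTwo) and `|X| + 1 ≤ 2^{r(X)}` (lines have `≤ 3` points) force `r ≥ 3`. -/
theorem five_le_ncard_union_of_circuits (M : Matroid α) [M.Finite]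
    (hfree : ∀ e ∈ M.E, ∃ A ⊆ M.E \ {e}, e ∉ M.closure A ∧ e ∉ M.closure ((M.E \ {e}) \ A))
    {C₁ C₂ : Set α} (h₁ : M.IsCircuit C₁) (h₂ : M.IsCircuit C₂) (hne : C₁ ≠ C₂) : 5 ≤ (C₁ ∪ C₂).ncard := by
  have hU : C₁ ∪ C₂ ⊆ M.E := union_subset h₁.subset_ground h₂.subset_ground
  obtain ⟨k, hk⟩ := ThmN.eRk_eq_nat_of_subset M hU
  have h1 := ThmN.eRk_union_add_two_le_of_circuits M h₁ h₂ hne hk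
  have h2 := ThmN.ncard_add_one_le_two_pow_of_eRk_le M (ThmN.not_isLoop_of_free M hfree) hfree k (C₁ ∪ C₂) hU hk.le
  have hk3 : 3 ≤ k := by
    by_contra hlt
    push Not at hlt
    interval_cases k <;> norm_num at h2 <;> omega
  omega

/-- **Three killers in the `8`-point core**: three pairwise distinct circuits of `≤ 4` elements inside `E'`, or two
distinct ones the second of which has `≤ 3` elements. -/
theorem exists_killers_eight (M : Matroid α) [M.Finite]
    (hfree : ∀ e ∈ M.E, ∃ A ⊆ M.E \ {e}, e ∉ M.closure A ∧ e ∉ M.closure ((M.E \ {e}) \ A))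
    (hd : M.E.encard = M.eRank + 4) (h8 : (M.E \ M.coloops).ncard = 8) :
    (∃ D₁ D₂ D₃ : Set α, M.IsCircuit D₁ ∧ M.IsCircuit D₂ ∧ M.IsCircuit D₃ ∧ D₁ ⊆ M.E \ M.coloops ∧
      D₂ ⊆ M.E \ M.coloops ∧ D₃ ⊆ M.E \ M.coloops ∧ D₁.ncard ≤ 4 ∧ D₂.ncard ≤ 4 ∧ D₃.ncard ≤ 4 ∧
      D₁ ≠ D₂ ∧ D₁ ≠ D₃ ∧ D₂ ≠ D₃) ∨
    (∃ D₁ D₂ : Set α, M.IsCircuit D₁ ∧ M.IsCircuit D₂ ∧ D₁ ⊆ M.E \ M.coloops ∧ D₂ ⊆ M.E \ M.coloops ∧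
      D₁.ncard ≤ 4 ∧ D₂.ncard ≤ 3 ∧ D₁ ≠ D₂) := by
  classical
  set E' := M.E \ M.coloops with hE'def
  have hE'sub : E' ⊆ M.E := sdiff_subset
  have hE'fin : E'.Finite := M.ground_finite.subset hE'sub
  have step : ∀ e ∈ E', ∃ D, M.IsCircuit D ∧ D ⊆ E' \ {e} ∧ D.ncard ≤ 4 := by
    intro e he
    obtain ⟨B, hBE, hB4, hBr, -, -⟩ := exists_big_half_eight M hfree hd h8 he
    have hBfin : B.Finite := hE'fin.subset (hBE.trans sdiff_subset)
    obtain ⟨d, hd'⟩ : B.Nonempty := by rw [← ncard_pos hBfin]; omega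
    obtain ⟨Y, hYB, hY4, -, D, hDY, hD⟩ :=
      exists_circuit_le_four_of_big_half M ((hBE.trans sdiff_subset).trans hE'sub) hB4 hBr hd'
    exact ⟨D, hD, hDY.trans (hYB.trans hBE), by rw [← hY4]; exact ncard_le_ncard hDY (hBfin.subset hYB)⟩
  obtain ⟨e₁, he₁⟩ : E'.Nonempty := by rw [← ncard_pos hE'fin]; omega
  obtain ⟨D₁, hD₁, hD₁E, hD₁4⟩ := step e₁ he₁
  obtain ⟨e₂, he₂⟩ := hD₁.nonempty
  have he₂E' : e₂ ∈ E' := (hD₁E he₂).1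
  obtain ⟨D₂, hD₂, hD₂E, hD₂4⟩ := step e₂ he₂E'
  have hne₁₂ : D₁ ≠ D₂ := fun h => (hD₂E (by rw [← h]; exact he₂)).2 (mem_singleton e₂)
  by_cases hint : (D₁ ∩ D₂).Nonempty
  · obtain ⟨e₃, he₃⟩ := hint
    obtain ⟨D₃, hD₃, hD₃E, hD₃4⟩ := step e₃ (hD₁E he₃.1).1
    refine Or.inl ⟨D₁, D₂, D₃, hD₁, hD₂, hD₃, hD₁E.trans sdiff_subset, hD₂E.trans sdiff_subset,
      hD₃E.trans sdiff_subset, hD₁4, hD₂4, hD₃4, hne₁₂, ?_, ?_⟩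
    · exact fun h => (hD₃E (by rw [← h]; exact he₃.1)).2 (mem_singleton e₃)
    · exact fun h => (hD₃E (by rw [← h]; exact he₃.2)).2 (mem_singleton e₃)
  · rw [Set.not_nonempty_iff_eq_empty] at hint
    rcases Nat.lt_or_ge D₂.ncard 4 with hD₂3 | hD₂4'
    · exact Or.inr ⟨D₁, D₂, hD₁, hD₂, hD₁E.trans sdiff_subset, hD₂E.trans sdiff_subset, hD₁4, by omega, hne₁₂⟩
    · -- `|D₂| = 4`, `D₁ ∩ D₂ = ∅`: the big half at `e₂` meets `D₁ ∖ {e₂}`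
      obtain ⟨B, hBE, hB4, hBr, -, heB'⟩ := exists_big_half_eight M hfree hd h8 he₂E'
      have hmeet : ∃ d ∈ B, d ∈ D₁ := by
        by_contra hno
        push Not at hno
        have hsub : D₁ \ {e₂} ⊆ (E' \ {e₂}) \ B :=
          fun x hx => ⟨⟨(hD₁E hx.1).1, hx.2⟩, fun hxB => hno x hxB hx.1⟩
        exact heB' (M.closure_subset_closure hsub (hD₁.mem_closure_sdiff_singleton_of_mem he₂))
      obtain ⟨d, hdB, hdD₁⟩ := hmeet
      obtain ⟨Y, hYB, hY4, hdY, D₃, hD₃Y, hD₃⟩ :=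
        exists_circuit_le_four_of_big_half M ((hBE.trans sdiff_subset).trans hE'sub) hB4 hBr hdB
      have hBfin : B.Finite := hE'fin.subset (hBE.trans sdiff_subset)
      have hYfin : Y.Finite := hBfin.subset hYB
      have hD₃4 : D₃.ncard ≤ 4 := by rw [← hY4]; exact ncard_le_ncard hD₃Y hYfin
      have he₂Y : e₂ ∉ Y := fun h => (hBE (hYB h)).2 (mem_singleton e₂)
      refine Or.inl ⟨D₁, D₂, D₃, hD₁, hD₂, hD₃, hD₁E.trans sdiff_subset, hD₂E.trans sdiff_subset,
        (hD₃Y.trans hYB).trans (hBE.trans sdiff_subset), hD₁4, hD₂4, hD₃4, hne₁₂, ?_, ?_⟩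
      · exact fun h => he₂Y (hD₃Y (by rw [← h]; exact he₂))
      · intro h
        have hD₂Y : D₂ ⊆ Y := by rw [h]; exact hD₃Y
        have hYeq : D₂ = Y := Set.eq_of_subset_of_ncard_le hD₂Y (by rw [hY4]; exact hD₂4') hYfin
        have hdD₂ : d ∈ D₂ := by rw [hYeq]; exact hdY
        have hmem : d ∈ D₁ ∩ D₂ := ⟨hdD₁, hdD₂⟩
        rw [hint] at hmem
        exact hmem

/-- **Every five-circuit avoids the killed five-subsets**: if every member of `K` contains a circuit of `≤ 4`
elements, then `s₅ ≤ |P ∖ K|`, `P` = the five-subsets of the `8`-point core. -/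
theorem ncard_fiveCircuits_le_card_sdiff (M : Matroid α) [M.Finite] [DecidableEq α]
    (hE'fin : (M.E \ M.coloops).Finite) (K : Finset (Finset α))
    (hK : ∀ S ∈ K, ∃ D : Set α, M.IsCircuit D ∧ D.ncard ≤ 4 ∧ D ⊆ (S : Set α)) :
    {C : Set α | M.IsCircuit C ∧ C.ncard = 5}.ncard ≤ ((hE'fin.toFinset.powersetCard 5) \ K).card := by
  set E' := M.E \ M.coloops with hE'def
  set Ef := hE'fin.toFinset with hEf
  have hsub : {C : Set α | M.IsCircuit C ∧ C.ncard = 5} ⊆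
      (fun S : Finset α => (S : Set α)) '' (((Ef.powersetCard 5) \ K : Finset (Finset α)) : Set (Finset α)) := by
    rintro C ⟨hC, hC5⟩
    have hCE' : C ⊆ E' := fun x hx => ⟨hC.subset_ground hx, hC.not_isColoop_of_mem hx⟩
    have hCfin : C.Finite := hE'fin.subset hCE'
    refine ⟨hCfin.toFinset, ?_, by simp⟩
    rw [Finset.mem_coe, Finset.mem_sdiff, Finset.mem_powersetCard]
    refine ⟨⟨?_, ?_⟩, ?_⟩
    · rw [hEf, Set.Finite.toFinset_subset_toFinset]; exact hCE'
    · rw [← ncard_eq_toFinset_card _ hCfin]; exact hC5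
    · intro hCK
      obtain ⟨D, hD, hD4, hDC⟩ := hK _ hCK
      rw [Set.Finite.coe_toFinset] at hDC
      have := hD.eq_of_subset_isCircuit hC hDC
      rw [this] at hD4
      omega
  calc {C : Set α | M.IsCircuit C ∧ C.ncard = 5}.ncard
      ≤ ((fun S : Finset α => (S : Set α)) '' (((Ef.powersetCard 5) \ K : Finset (Finset α)) : Set (Finset α))).ncard :=
        ncard_le_ncard hsub (((Ef.powersetCard 5) \ K).finite_toSet.image _)
    _ ≤ ((((Ef.powersetCard 5) \ K : Finset (Finset α)) : Set (Finset α))).ncard :=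
        ncard_image_le ((Ef.powersetCard 5) \ K).finite_toSet
    _ = ((Ef.powersetCard 5) \ K).card := ncard_coe_finset _

/-- **`s₅ ≤ 47` on a core of nullity `4` with exactly `8` non-coloops**: three distinct small circuits kill `≥ 9` of
the `56` five-subsets (or a triangle and one more kill `≥ 13`). -/
theorem ncard_fiveCircuits_le_forty_seven_of_eight (M : Matroid α) [M.Finite]
    (hfree : ∀ e ∈ M.E, ∃ A ⊆ M.E \ {e}, e ∉ M.closure A ∧ e ∉ M.closure ((M.E \ {e}) \ A))
    (hd : M.E.encard = M.eRank + 4) (h8 : (M.E \ M.coloops).ncard = 8) :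
    {C : Set α | M.IsCircuit C ∧ C.ncard = 5}.ncard ≤ 47 := by
  classical
  set E' := M.E \ M.coloops with hE'def
  have hE'sub : E' ⊆ M.E := sdiff_subset
  have hE'fin : E'.Finite := M.ground_finite.subset hE'sub
  set Ef := hE'fin.toFinset with hEf
  have hEfcard : Ef.card = 8 := by rw [hEf, ← ncard_eq_toFinset_card _ hE'fin]; exact h8
  have hPcard : (Ef.powersetCard 5).card = 56 := by rw [Finset.card_powersetCard, hEfcard]; rfl
  -- the killer of a circuit `D ⊆ E'`
  have hkill : ∀ D : Set α, D ⊆ E' → ∃ Df : Finset α, (Df : Set α) = D ∧ Df ⊆ Ef ∧ Df.card = D.ncard := by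
    intro D hDE'
    have hDfin : D.Finite := hE'fin.subset hDE'
    refine ⟨hDfin.toFinset, Set.Finite.coe_toFinset _, ?_, (ncard_eq_toFinset_card _ hDfin).symm⟩
    rw [hEf, Set.Finite.toFinset_subset_toFinset]; exact hDE'
  -- the overlap of two killers of distinct circuits is at most one five-subset
  have hover : ∀ (D D' : Set α) (Df Df' : Finset α), (Df : Set α) = D → (Df' : Set α) = D' → M.IsCircuit D →
      M.IsCircuit D' → D ≠ D' →
      ((Ef.powersetCard 5).filter (fun S => Df ⊆ S) ∩ (Ef.powersetCard 5).filter (fun S => Df' ⊆ S)).card ≤ 1 := by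
    intro D D' Df Df' hDf hDf' hD hD' hne
    rw [filter_subset_inter]
    apply card_filter_subset_le_one
    have h5 := five_le_ncard_union_of_circuits M hfree hD hD' hne
    rw [← ncard_coe_finset, Finset.coe_union, hDf, hDf']
    exact h5
  -- the generic final step
  have hfinal : ∀ K : Finset (Finset α), K ⊆ Ef.powersetCard 5 → 9 ≤ K.card →
      (∀ S ∈ K, ∃ D : Set α, M.IsCircuit D ∧ D.ncard ≤ 4 ∧ D ⊆ (S : Set α)) →
      {C : Set α | M.IsCircuit C ∧ C.ncard = 5}.ncard ≤ 47 := by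
    intro K hKP hK9 hK
    have h := ncard_fiveCircuits_le_card_sdiff M hE'fin K hK
    rw [Finset.card_sdiff_of_subset hKP] at h
    omega
  rcases exists_killers_eight M hfree hd h8 with
    ⟨D₁, D₂, D₃, hD₁, hD₂, hD₃, hD₁E, hD₂E, hD₃E, hD₁4, hD₂4, hD₃4, h12, h13, h23⟩ |
    ⟨D₁, D₂, hD₁, hD₂, hD₁E, hD₂E, hD₁4, hD₂3, h12⟩
  · obtain ⟨Df₁, hf₁, hf₁E, hf₁c⟩ := hkill D₁ hD₁E
    obtain ⟨Df₂, hf₂, hf₂E, hf₂c⟩ := hkill D₂ hD₂E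
    obtain ⟨Df₃, hf₃, hf₃E, hf₃c⟩ := hkill D₃ hD₃E
    have h1 := four_le_card_filter_subset Ef Df₁ hEfcard hf₁E (by omega)
    have h2 := four_le_card_filter_subset Ef Df₂ hEfcard hf₂E (by omega)
    have h3 := four_le_card_filter_subset Ef Df₃ hEfcard hf₃E (by omega)
    have o12 := hover D₁ D₂ Df₁ Df₂ hf₁ hf₂ hD₁ hD₂ h12
    have o13 := hover D₁ D₃ Df₁ Df₃ hf₁ hf₃ hD₁ hD₃ h13
    have o23 := hover D₂ D₃ Df₂ Df₃ hf₂ hf₃ hD₂ hD₃ h23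
    have hB := card_union_three_ge ((Ef.powersetCard 5).filter (fun S => Df₁ ⊆ S))
      ((Ef.powersetCard 5).filter (fun S => Df₂ ⊆ S)) ((Ef.powersetCard 5).filter (fun S => Df₃ ⊆ S))
    refine hfinal ((Ef.powersetCard 5).filter (fun S => Df₁ ⊆ S) ∪ (Ef.powersetCard 5).filter (fun S => Df₂ ⊆ S) ∪
      (Ef.powersetCard 5).filter (fun S => Df₃ ⊆ S)) ?_ (by omega) ?_
    · exact Finset.union_subset (Finset.union_subset (Finset.filter_subset _ _) (Finset.filter_subset _ _))
        (Finset.filter_subset _ _)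
    · intro S hS
      rcases Finset.mem_union.1 hS with hS | hS
      · rcases Finset.mem_union.1 hS with hS | hS
        · exact ⟨D₁, hD₁, hD₁4, by rw [← hf₁]; exact_mod_cast (Finset.mem_filter.1 hS).2⟩
        · exact ⟨D₂, hD₂, hD₂4, by rw [← hf₂]; exact_mod_cast (Finset.mem_filter.1 hS).2⟩
      · exact ⟨D₃, hD₃, hD₃4, by rw [← hf₃]; exact_mod_cast (Finset.mem_filter.1 hS).2⟩
  · obtain ⟨Df₁, hf₁, hf₁E, hf₁c⟩ := hkill D₁ hD₁E
    obtain ⟨Df₂, hf₂, hf₂E, hf₂c⟩ := hkill D₂ hD₂E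
    have h1 := four_le_card_filter_subset Ef Df₁ hEfcard hf₁E (by omega)
    have h2 := ten_le_card_filter_subset Ef Df₂ hEfcard hf₂E (by omega)
    have o12 := hover D₁ D₂ Df₁ Df₂ hf₁ hf₂ hD₁ hD₂ h12
    have hB := Finset.card_union_add_card_inter ((Ef.powersetCard 5).filter (fun S => Df₁ ⊆ S))
      ((Ef.powersetCard 5).filter (fun S => Df₂ ⊆ S))
    refine hfinal ((Ef.powersetCard 5).filter (fun S => Df₁ ⊆ S) ∪ (Ef.powersetCard 5).filter (fun S => Df₂ ⊆ S))
      (Finset.union_subset (Finset.filter_subset _ _) (Finset.filter_subset _ _)) (by omega) ?_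
    intro S hS
    rcases Finset.mem_union.1 hS with hS | hS
    · exact ⟨D₁, hD₁, hD₁4, by rw [← hf₁]; exact_mod_cast (Finset.mem_filter.1 hS).2⟩
    · exact ⟨D₂, hD₂, by omega, by rw [← hf₂]; exact_mod_cast (Finset.mem_filter.1 hS).2⟩

/-- **`s₅ ≤ 47` on every `e`-free core of nullity `4`** (p2's `47` for `≥ 9` non-coloops; `47` for exactly `8`). -/
theorem ncard_fiveCircuits_le_forty_seven (M : Matroid α) [M.Finite]
    (hfree : ∀ e ∈ M.E, ∃ A ⊆ M.E \ {e}, e ∉ M.closure A ∧ e ∉ M.closure ((M.E \ {e}) \ A))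
    (hd : M.E.encard = M.eRank + 4) : {C : Set α | M.IsCircuit C ∧ C.ncard = 5}.ncard ≤ 47 := by
  obtain ⟨r', _, hE'n, hr4⟩ := nonColoops_nullity_four M hfree hd
  rcases Nat.lt_or_ge (M.E \ M.coloops).ncard 9 with h | h
  · exact ncard_fiveCircuits_le_forty_seven_of_eight M hfree hd (by omega)
  · exact ncard_fiveCircuits_le_forty_seven_of_nine M hfree hd h

/-- The `s₅` chain restarted from `47` at nullity `4`: `105, 210` at `ν = 5, 6` (`m = 9, 10`), then
`avgChain5c (n + 7) = ⌊(n + 12)·avgChain5c (n + 6)/(n + 7)⌋`: `360, 585, 910, 1365, 2032, …` (p2's `avgChain5b` is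
`52, 117, 234, 401, 651, 1012, 1518, 2258`). -/
def avgChain5c : ℕ → ℕ
  | 0 => 0
  | 1 => 1
  | 2 => 6
  | 3 => 21
  | 4 => 47
  | 5 => 105
  | 6 => 210
  | n + 7 => (n + 12) * avgChain5c (n + 6) / (n + 12 - 5)

/-- The values `avgChain5c 7 … 10 = 360, 585, 910, 1365`. -/
theorem avgChain5c_values : avgChain5c 7 = 360 ∧ avgChain5c 8 = 585 ∧ avgChain5c 9 = 910 ∧
    avgChain5c 10 = 1365 := by decide

/-- `avgChain5c ≤ avgChain5b` at every nullity. -/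
theorem avgChain5c_le_avgChain5b : ∀ j, avgChain5c j ≤ avgChain5b j
  | 0 | 1 | 2 | 3 | 4 | 5 | 6 => by decide
  | n + 7 => by
    show (n + 12) * avgChain5c (n + 6) / (n + 12 - 5) ≤ (n + 12) * avgChain5b (n + 6) / (n + 12 - 5)
    exact Nat.div_le_div_right (Nat.mul_le_mul_left _ (avgChain5c_le_avgChain5b (n + 6)))

/-- **`s₅ ≤ avgChain5c ν` on every core of nullity `ν`**, unconditionally (p2's `ncard_fiveCircuits_le_avgChain5b`
restarted from `47`). -/
theorem ncard_fiveCircuits_le_avgChain5c : ∀ (j : ℕ) (M : Matroid α) [M.Finite],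
    (∀ e ∈ M.E, ∃ A ⊆ M.E \ {e}, e ∉ M.closure A ∧ e ∉ M.closure ((M.E \ {e}) \ A)) →
    M.E.encard = M.eRank + j → {C : Set α | M.IsCircuit C ∧ C.ncard = 5}.ncard ≤ avgChain5c j
  | 0, M, _, _, hd => (ncard_circuits_five_le M hd).trans (by decide)
  | 1, M, _, _, hd => (ncard_circuits_five_le M hd).trans (by decide)
  | 2, M, _, _, hd => (ncard_circuits_five_le M hd).trans (by decide)
  | 3, M, _, _, hd => (ncard_circuits_five_le M hd).trans (by decide)
  | 4, M, _, hfree, hd => ncard_fiveCircuits_le_forty_seven M hfree (by exact_mod_cast hd)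
  | 5, M, _, hfree, hd => by
    have hd' : M.E.encard = M.eRank + ((4 : ℕ) + 1) := by rw [hd]; norm_num
    have h := ncard_fiveCircuits_sub_div_le_of_nonColoops M hfree hd' (by norm_num)
      (card_nonColoops_ge_nine M hfree (by exact_mod_cast hd)) (B := 47)
      (fun M' _ hfree' hd4 => ncard_fiveCircuits_le_forty_seven M' hfree' (by exact_mod_cast hd4))
    show _ ≤ 105
    omega
  | 6, M, _, hfree, hd => by
    have hd' : M.E.encard = M.eRank + ((5 : ℕ) + 1) := by rw [hd]; norm_num
    have h := ncard_fiveCircuits_sub_div_le_of_nonColoops M hfree hd' (by norm_num)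
      (card_nonColoops_ge_ten M hfree (by exact_mod_cast hd)) (B := 105)
      (fun M' _ hfree' hd5 => ncard_fiveCircuits_le_avgChain5c 5 M' hfree' (by exact_mod_cast hd5))
    show _ ≤ 210
    omega
  | n + 7, M, _, hfree, hd => by
    have hd' : M.E.encard = M.eRank + ((n + 6 : ℕ) + 1) := by rw [hd]; push_cast; ring
    have hm : n + 12 ≤ (M.E \ M.coloops).ncard := card_nonColoops_ge M hfree hd' (by omega)
    have h := ncard_fiveCircuits_sub_div_le_of_nonColoops M hfree hd' (by omega) hm
      (fun M' _ hfree' hd6 => ncard_fiveCircuits_le_avgChain5c (n + 6) M' hfree' hd6)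
    have h2 := le_mul_div_of_sub_div_le_five (m := n + 12) (by omega) h
    show _ ≤ (n + 12) * avgChain5c (n + 6) / (n + 12 - 5)
    exact h2

end S1

end PercRepro
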